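import Literature.NumberTheory.Automorphic.LocalPiSchwartzBruhatFourier
import Literature.NumberTheory.Automorphic.TateLocalZetaShells
import HarnessLib

/-!
# Anisotropic homogeneous forms over a non-archimedean local field are COERCIVE

Topic `NumberTheory/Automorphic`; namespace `Literature.NumberTheory.Automorphic`.  KERNEL ONLY: theorems; no definition, no
named fact, no record, no `sorry`.  Generic form of §2 of `UnitaryGroupLocalNormFormCoercive.lean` (there: the norm form
`α² - dβ²` of a quadratic field extension `E_v/F_v`), written for the Hodge/COR-CM cell's rank-TWO lattice-model support bound
(IV-4(c1) piece (β): the 4-variable form `(z₁, z₂) ↦ ε₁·N(z₁) - ε₂·N(z₂)` on `E_v²`, anisotropic iff `ε₁/ε₂` is not a norm).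

**What is proved** (`exists_coercivity_of_anisotropic`): let `K` be a non-archimedean local field, `ι` a finite index type,
`p ≠ 0`, and `Q : K^ι → K` continuous, homogeneous of degree `p` (`Q (a • x) = a ^ p * Q x`) and ANISOTROPIC (`Q x = 0 → x = 0`).
Then there is `k₀ ∈ ℤ` with `q^{-k₀} · ‖x‖^p ≤ |Q x|` for every `x`, where `‖x‖ = maxᵢ |xᵢ|` is the sup-norm of the coordinates
(`|·| = normAbs K`, `q` the residue cardinality).  Proof ([WeilBNT1967, Chap. II §1 Prop. 1 and Cor. 1–2]: a `K`-norm is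
comparable to the sup-norm; here run directly): the "unit sphere" `S = (𝒪^ι) ∖ (𝔭^ι)` is compact (`isCompact_piPrimePowBall` minus an
open box), `Q` does not vanish on it, so `0 ∉ Q(S)` and a whole ball `𝔭^{k₀}` misses the compact `Q(S)`; every `x ≠ 0` is scaled
onto `S` by a scalar `a` with `|a| · ‖x‖ = 1` (the value group is `q^ℤ`, `exists_normAbs_eq_inv_zpow_of_int`), and
`Q (a • x) = a^p Q x` transports the bound.

Also the specialisation to PAIRS of coordinates used by the cell (`exists_coercivity_of_anisotropic₄`: four variables, sup of four
absolute values), so that consumers need not handle `Finset.sup`.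

## References
* [WeilBNT1967] A. Weil, *Basic Number Theory* (1967), Chap. II §1, Def. 1, Prop. 1, Cor. 1–2 (norms on vector spaces over local fields).
* [MoeglinVignerasWaldspurger1987] C. Mœglin, M.-F. Vignéras, J.-L. Waldspurger, LNM 1291 (1987), Chap. 1 I.11 (anisotropic forms).
-/

set_option autoImplicit false

noncomputable section

open Filter
open scoped NNReal Topology
open Literature.NumberTheory.GaloisRepresentations.IsNonarchimedeanLocalField

namespace Literature.NumberTheory.Automorphic

variable {K : Type*} [Field K] [ValuativeRel K] [TopologicalSpace K] [IsNonarchimedeanLocalField K]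

/-- **Coercivity of an anisotropic homogeneous form** over a non-archimedean local field: if `Q : K^ι → K` is continuous,
homogeneous of degree `p ≠ 0` and has no non-trivial zero, then `q^{-k₀} · (maxᵢ |xᵢ|)^p ≤ |Q x|` for some `k₀` and all `x`
(compactness of the sphere `𝒪^ι ∖ 𝔭^ι` + scaling by the value group `q^ℤ`).
[cite: WeilBNT1967, Chap. II §1 Prop. 1 Cor. 1–2] -/
theorem exists_coercivity_of_anisotropic {ι : Type*} [Fintype ι] {p : ℕ} (hp : p ≠ 0) (Q : (ι → K) → K)
    (hQc : Continuous Q) (hQh : ∀ (a : K) (x : ι → K), Q (a • x) = a ^ p * Q x) (hQa : ∀ x, Q x = 0 → x = 0) :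
    ∃ k₀ : ℤ, ∀ x : ι → K,
      ((residueFieldCard K : ℝ≥0)⁻¹) ^ k₀ * (Finset.univ.sup fun i => normAbs K (x i)) ^ p ≤ normAbs K (Q x) := by
  classical
  haveI : T2Space K := (GaloisRepresentations.IsNonarchimedeanLocalField.isLocalField K).toT2Space
  set ρ : ℝ≥0 := ((residueFieldCard K : ℝ≥0)⁻¹) with hρ
  have hρ0 : ρ ≠ 0 := inv_residueFieldCard_pos.ne'
  -- the sphere `S = 𝒪^ι ∖ 𝔭^ι` is compact and `Q` does not vanish on it
  set S : Set (ι → K) := piPrimePowBall K ι 0 \ piPrimePowBall K ι 1 with hS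
  have hSc : IsCompact S := (isCompact_piPrimePowBall 0).diff (isOpen_piPrimePowBall 1)
  have h0 : (0 : K) ∉ Q '' S := by
    rintro ⟨x, hx, hx0⟩
    have hx00 : x = 0 := hQa x hx0
    subst hx00
    exact hx.2 (zero_mem_piPrimePowBall 1)
  have hopen : (Q '' S)ᶜ ∈ 𝓝 (0 : K) := (hSc.image hQc).isClosed.isOpen_compl.mem_nhds h0
  obtain ⟨k₀, hk₀⟩ := exists_primePowBall_subset_of_mem_nhds_zero hopen
  refine ⟨k₀, fun x => ?_⟩
  have hsphere : ∀ y ∈ S, ρ ^ (k₀ : ℤ) < normAbs K (Q y) := by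
    intro y hy
    by_contra hle
    exact hk₀ ((mem_primePowBall_iff).2 (not_lt.1 hle)) ⟨y, hy, rfl⟩
  -- the sup-norm `m`; the case `x = 0`
  set m : ℝ≥0 := Finset.univ.sup fun i => normAbs K (x i) with hm
  by_cases hx : x = 0
  · subst hx
    have hm0 : m = 0 := by
      rw [hm]
      exact le_antisymm (Finset.sup_le fun i _ => by rw [Pi.zero_apply, map_zero]) zero_le
    rw [hm0, zero_pow hp, mul_zero]
    exact zero_le
  -- `m = |x i₀| = ρ^e ≠ 0`
  obtain ⟨i₁, hi₁⟩ : ∃ i, x i ≠ 0 := by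
    by_contra h
    exact hx (funext fun i => not_not.1 fun hi => h ⟨i, hi⟩)
  obtain ⟨i₀, -, hi₀⟩ := Finset.exists_mem_eq_sup (Finset.univ : Finset ι) ⟨i₁, Finset.mem_univ _⟩ fun i => normAbs K (x i)
  have hle : ∀ i, normAbs K (x i) ≤ m := fun i => Finset.le_sup (f := fun i => normAbs K (x i)) (Finset.mem_univ i)
  have hm0 : m ≠ 0 := by
    intro h
    apply hi₁
    have := hle i₁
    rw [h] at this
    exact (map_eq_zero (normAbs K)).1 (le_antisymm this zero_le)
  have hxi₀ : x i₀ ≠ 0 := by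
    intro h
    apply hm0
    rw [hm, hi₀, h, map_zero]
  obtain ⟨e, he⟩ := exists_normAbs_eq_inv_zpow hxi₀
  have hme : m = ρ ^ e := by rw [hm, hi₀, he]
  -- scale onto the sphere
  obtain ⟨a, ha0, ha⟩ := exists_normAbs_eq_inv_zpow_of_int (F := K) (-e)
  have hea : normAbs K a * m = 1 := by
    rw [ha, hme, ← zpow_add₀ hρ0, neg_add_cancel, zpow_zero]
  have hmem : a • x ∈ S := by
    refine ⟨mem_piPrimePowBall_iff.2 fun i => ?_, fun h1 => ?_⟩
    · rw [mem_primePowBall_iff, Pi.smul_apply, smul_eq_mul, map_mul, zpow_zero, ← hea]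
      exact mul_le_mul' le_rfl (hle i)
    · have hi := mem_piPrimePowBall_iff.1 h1 i₀
      rw [mem_primePowBall_iff, Pi.smul_apply, smul_eq_mul, map_mul, zpow_one] at hi
      have : normAbs K a * m ≤ ρ := by rw [hm, hi₀]; exact hi
      rw [hea] at this
      exact not_lt.2 this inv_residueFieldCard_lt_one
  have key := hsphere _ hmem
  rw [hQh, map_mul, map_pow] at key
  -- `ρ^{k₀} < |a|^p |Q x|` and `|a| m = 1` give `ρ^{k₀} m^p ≤ |Q x|`
  have hmp : 0 < m ^ p := pow_pos (pos_iff_ne_zero.2 hm0) p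
  have : ρ ^ k₀ * m ^ p < normAbs K a ^ p * normAbs K (Q x) * m ^ p := mul_lt_mul_of_pos_right key hmp
  rw [mul_right_comm, ← mul_pow, hea, one_pow, one_mul] at this
  exact this.le

/-- **Four-variable form** of `exists_coercivity_of_anisotropic` (the shape used for pairs `(z₁, z₂) ∈ E_v²` in coordinates
`(re z₁, im z₁, re z₂, im z₂)`): for `Q : K → K → K → K → K` continuous, homogeneous of degree `p ≠ 0` and anisotropic,
`q^{-k₀} · max(|α₁|,|β₁|,|α₂|,|β₂|)^p ≤ |Q α₁ β₁ α₂ β₂|`. [cite: WeilBNT1967, Chap. II §1 Prop. 1 Cor. 1–2] -/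
theorem exists_coercivity_of_anisotropic₄ {p : ℕ} (hp : p ≠ 0) (Q : K → K → K → K → K)
    (hQc : Continuous fun x : Fin 4 → K => Q (x 0) (x 1) (x 2) (x 3))
    (hQh : ∀ (a α₁ β₁ α₂ β₂ : K), Q (a * α₁) (a * β₁) (a * α₂) (a * β₂) = a ^ p * Q α₁ β₁ α₂ β₂)
    (hQa : ∀ α₁ β₁ α₂ β₂, Q α₁ β₁ α₂ β₂ = 0 → α₁ = 0 ∧ β₁ = 0 ∧ α₂ = 0 ∧ β₂ = 0) :
    ∃ k₀ : ℤ, ∀ α₁ β₁ α₂ β₂ : K,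
      ((residueFieldCard K : ℝ≥0)⁻¹) ^ k₀ *
          max (max (normAbs K α₁) (normAbs K β₁)) (max (normAbs K α₂) (normAbs K β₂)) ^ p ≤
        normAbs K (Q α₁ β₁ α₂ β₂) := by
  obtain ⟨k₀, hk₀⟩ := exists_coercivity_of_anisotropic (ι := Fin 4) hp (fun x => Q (x 0) (x 1) (x 2) (x 3)) hQc
    (fun a x => by simp only [Pi.smul_apply, smul_eq_mul]; exact hQh a (x 0) (x 1) (x 2) (x 3))
    (fun x hx => by
      obtain ⟨h0, h1, h2, h3⟩ := hQa _ _ _ _ hx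
      ext i
      fin_cases i <;> simp [h0, h1, h2, h3])
  refine ⟨k₀, fun α₁ β₁ α₂ β₂ => ?_⟩
  have h := hk₀ ![α₁, β₁, α₂, β₂]
  set sup : ℝ≥0 := Finset.univ.sup fun i : Fin 4 => normAbs K (![α₁, β₁, α₂, β₂] i) with hsup
  have hi : ∀ i : Fin 4, normAbs K (![α₁, β₁, α₂, β₂] i) ≤ sup := fun i =>
    Finset.le_sup (f := fun i : Fin 4 => normAbs K (![α₁, β₁, α₂, β₂] i)) (Finset.mem_univ i)
  have hM : max (max (normAbs K α₁) (normAbs K β₁)) (max (normAbs K α₂) (normAbs K β₂)) ≤ sup :=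
    max_le (max_le (by simpa using hi 0) (by simpa using hi 1)) (max_le (by simpa using hi 2) (by simpa using hi 3))
  calc ((residueFieldCard K : ℝ≥0)⁻¹) ^ k₀ *
          max (max (normAbs K α₁) (normAbs K β₁)) (max (normAbs K α₂) (normAbs K β₂)) ^ p
        ≤ ((residueFieldCard K : ℝ≥0)⁻¹) ^ k₀ * sup ^ p :=
          mul_le_mul' le_rfl (pow_le_pow_left' hM p)
    _ ≤ normAbs K (Q α₁ β₁ α₂ β₂) := h

end Literature.NumberTheory.Automorphic

end
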